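import Literature.MathematicalPhysics.QuantumLattice.GaugedHubbardTorus

/-!
# `SgCorridor` (stmt-HubbardSuperconductivity-16274, route `ColourTheSpin`) — negative side:
# the `B1g` bond form factor is blind to every site-local channel

The crux `SgCorridor := SgAnchorOrder → SgCorridorOrder` is vacuous as typed (`SgAnchorOrder` is
refuted by strong-coupling link freezing, `Theorems/SgCorridor/Negative/AnchorFreeze*.lean`). The
planner's repairs of the anchor that keep a STRONG-coupling end (order at one coupling `g₀`,
`g`-dependent constants, Gauss-law typing) all run into the same selection rule: at large `g` the
gauge-covariant bond pair field `Δ_b = Σ_{στ} (ερ(k_b))_{στ} c_{xσ} c_{x+e_i,τ}`, dressed back into the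
low-energy sector, is at leading order `(t/g²)` times a SITE-LOCAL operator at the two ends of the
bond, `D_x + D_{x+e_i}` (`D_x = c_{x↓}c_{x↑}`, the on-site doublon annihilator — the only
flux-free two-fermion annihilator, by `Z₂`-centre charge conservation at every site), and the `B1g`
combination of ANY such bond-end-local field vanishes identically:

  `Σ_{b = (x,i)} g_d(i) · (D_x + D_{x+e_i}) = Σ_i g_d(i) · 2 Σ_x D_x = 2 (1 - 1) Σ_x D_x = 0`

(translation invariance of the site sum along each axis; `g_d(0) = 1`, `g_d(1) = -1` is the route's
inlined form factor `if b.2 = 0 then 1 else -1` on `GaugedHubbard.Bond L = FermionTorus 2 L × Fin 2`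
with bond ends `b.1`, `b.1.shift b.2`). So the `d_{x²-y²}` channel sees no site-local (`A1g`)
condensate at all — the strong-coupling end of the gauged family carries no `B1g` order to leading
order in `t/g²`, whatever the typing of the anchor.

* `sum_shift_eq` — `Σ_x D(x + e_μ) = Σ_x D(x)` on the fermionic torus;
* `dWave_bondSum_onsite_eq_zero` — `Σ_b g_d(b) • (D(b.1) + D(b.1 + e_{b.2})) = 0` for every
  `D : FermionTorus 2 L → M`, `M` any `ℂ`-module (operators included).

Elementary (finite translation invariance); folklore. Refuter cdisprove, 2026-08-17.
-/

namespace Summit.HubbardSuperconductivity.SgCorridorNegative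

open Literature.MathematicalPhysics.QuantumLattice

variable {L : ℕ} [NeZero L]

/-- Translation invariance of site sums on the fermionic torus: `Σ_x D(x + e_μ) = Σ_x D(x)`.
[folklore] -/
theorem sum_shift_eq {M : Type*} [AddCommMonoid M] (D : FermionTorus 2 L → M) (μ : Fin 2) :
    ∑ x : FermionTorus 2 L, D (x.shift μ) = ∑ x : FermionTorus 2 L, D x := by
  have h := Equiv.sum_comp (FermionTorus.shiftEquiv (d := 2) (L := L) μ) D
  simpa only [FermionTorus.shiftEquiv_apply] using h

/-- **The `B1g` bond form factor kills every bond-end-local field**: for any assignment `D` of an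
element of a `ℂ`-module to each site (e.g. the on-site doublon annihilator `c_{x↓}c_{x↑}`),
`Σ_{b} g_d(b) • (D(b.1) + D(b.1 + e_{b.2})) = 0`, where `g_d = +1` on `x`-bonds and `-1` on `y`-bonds is
the route's inlined `d_{x²-y²}` form factor. Hence no site-local (`A1g`) condensate is visible in the
`B1g` pair channel of `SgAnchorOrder` / `SgCorridorOrder`. [folklore] -/
theorem dWave_bondSum_onsite_eq_zero {M : Type*} [AddCommGroup M] [Module ℂ M]
    (D : FermionTorus 2 L → M) :
    ∑ b : GaugedHubbard.Bond L,
      (if b.2 = 0 then (1 : ℂ) else -1) • (D b.1 + D (b.1.shift b.2)) = 0 := by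
  rw [Fintype.sum_prod_type]
  simp only [Fin.sum_univ_two, Fin.isValue, ↓reduceIte, one_smul, one_ne_zero, neg_smul,
    Finset.sum_add_distrib, Finset.sum_neg_distrib, sum_shift_eq D 0, sum_shift_eq D 1]
  abel

/-- The same selection rule for bond-end-local fields with DIFFERENT weights at the two ends
(`α • D(x) + β • D(x + e_i)`, e.g. a dressed pair field annihilating the doublon at either end with
unequal amplitudes): the `B1g` bond sum still vanishes. [folklore] -/
theorem dWave_bondSum_onsite_weighted_eq_zero {M : Type*} [AddCommGroup M] [Module ℂ M]
    (D : FermionTorus 2 L → M) (α β : ℂ) :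
    ∑ b : GaugedHubbard.Bond L,
      (if b.2 = 0 then (1 : ℂ) else -1) • (α • D b.1 + β • D (b.1.shift b.2)) = 0 := by
  rw [Fintype.sum_prod_type]
  simp only [Fin.sum_univ_two, Fin.isValue, ↓reduceIte, one_smul, one_ne_zero, neg_smul,
    Finset.sum_add_distrib, Finset.sum_neg_distrib, ← Finset.smul_sum,
    sum_shift_eq D 0, sum_shift_eq D 1]
  abel

end Summit.HubbardSuperconductivity.SgCorridorNegative
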